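import Literature.IUT.HodgeArakelov.ThetaEnvDataRecordProp31OfThetaKummerOrbit
import HarnessLib

/-!
# [IUTchII] Prop 3.1 (i)(ii): the PACKAGED `Prop31Statements` AND the `θ`-half «`(M^×_TM, ⟨θ^ι_env⟩)` is a splitting up to
# torsion at EVERY label `ι`» AT THE GENUINE `θ_env` RECORD OF THE TATE MODEL `modelTate p`, print-faithful OUTER inversion
# family through the pointed pair (proof-only; K-L6 instance bookkeeping)

S. Mochizuki, *Inter-universal Teichmüller theory II*, kurims manuscript (Dec. 2020), §3 Prop. 3.1 (i) p. 87 l. 47–53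
(«… splittings up to torsion … determined by the subsets `M^×_TM(M^Θ_*)`, `θ^ι_env(M^Θ_*)` … `∞θ^ι_env(M^Θ_*)`»), (ii) p. 88
[cite: Mochizuki2012, Prop 3.1 (i) p.87]. Claim key `Mochizuki2012` (D-0012, DISPUTED): nothing of the series is asserted;
composition of LANDED theorems over the cell's OWN model objects; no side taken on [IUTchIII] Cor. 3.12. PROOF-ONLY companion
(abc-iut cell, layer L6, seat abc-iut-w5-d031 gen 12; cone node IUTchII:Prop3.1(i), K-L6 instance of record; L-F row LF6-02 =
FACT-LIST row F-2567 `TemperedThetaMonoids.Prop31Statements`, «schema; instance forms are the content»). NO definition, NO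
`Prop` fact, NO instance; nothing landed is edited.

WHAT. abc-iut-w5-d072's K-L6 closer of record `EtaleLevels.splitting_toRecord_padic_of_eval_modelTate` (p461404) proves, at
the genuine `θ_env` record of `modelTate p` (Galois factor `inr`, class `η̈♯ = etaDdχq`, `X̲̲ := Huuχq`, root cocycle `rootLift`,
cyclotome family of a tower `τ`, empty cusp labelling, `l` an odd prime with `4l ∣ p − 1`), BOTH one-label clauses of
[IUTchII] Prop. 3.1 (i) — `(M^×_TM, ⟨∞θ^{i₀}_env⟩)` AND `(M^×_TM, ⟨θ^{i₀}_env⟩)` are splittings up to torsion — at ONE label `i₀`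
of an arbitrary inversion family whose `i₀`-th action is the transport `e₀ := pairRhoLim …` of the pointed inversion PAIR
`(inversionAlpha C ι hι, ι^Θ)`, `ι := inversionχq`. abc-iut-w5-d031 gen 11 (p493591,
`prop31Statements_thetaEnvRecordOuterKummer_modelTate`) used its FIRST half at the print-faithful OUTER family of record
(abc-iut-w4-d019's `thetaEnvRecordOuterKummer … e₀ c hA hfi O`: the `Π^tp_{X̲̲}`-conjugates `conj_g ∘ e₀ ∘ conj_g⁻¹`, whose
label-`1` member IS `e₀` by `CohomologySystemOfContH1.h1LimConjEquiv_one_conj_outer`) to obtain the packaged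
`Prop31Statements`. THIS FILE feeds BOTH halves to abc-iut-L6-d3 gen 8's generic outer-family packaging
`prop31Statements_and_thetaEnv_thetaEnvRecordOuterKummer_of_splittings_one` (p494934 §3: both one-label clauses at the label
`1` ⇒ `Prop31Statements` ∧ the `θ`-half at EVERY label, the latter by reaching every label from `1` along the conjugation
action, `isSplittingUpToTorsion_thetaEnv_of_reach` + `exists_image_conj_thetaEnv_thetaEnvRecordOuter`):
**`prop31Statements_and_thetaEnv_thetaEnvRecordOuterKummer_modelTate`** — at the model of record, the WHOLE
`Prop31Statements` AND, for EVERY label `ι ∈ Π^tp_{X̲̲}`, `(M^×_TM, ⟨θ^ι_env⟩)` is a splitting up to torsion (the `θ^ι_env`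
clause of Prop. 3.1 (i), which the typed schema `Prop31Statements` records only for `∞θ^ι_env`). RESIDUAL (every binder after
the `let`s, BY NAME) = p493591's EXACTLY: {(H1) `PiYddCharacteristic C` (F-2633 AT THE INSTANCE), the tower `τ` (DATA),
`Π^tp_{X̲̲}`-stability of the constant monoid `O` (`hOst`), and the [IUTchII] Cor. 3.5 (K)/(E) DATA exactly as in p461404:
constants `c`/`c₀` on `ℚ̄_pˣ` bijective with `μ ⊆ O` and `c₀ = c` on elements, ONE evaluation section `s₀` with `hact` and
finite-index image, a base point `θ ∈ θ^{1}_env` with evaluation `R₀ θ = κ₀ q`, `q` a non-unit} — NO ι-datum binder, NO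
class-level binder, NO §1-fact binder, NO inversion-family binder. (Signature and binder telescope = p493591's VERBATIM — a drop-in
strengthening; only the record's `let hS` is listed before `let hC`.)

HONEST LABEL. `modelTate` is a SEMI-SYNTHETIC model of the typed [EtTh] §1 interface (not the tempered `π₁` of a curve,
no theta FUNCTION): binder-discharge / joint-satisfiability evidence for the typed interface only; an instance at OUR model
is not the print universal closure (refuted as a schema). Nothing of [IUTchII]/[EtTh] is asserted; no side is taken on
[IUTchIII] Cor. 3.12 nor on which lift of the inversion print's `ι` denotes; typed ≠ proved; instantiated ≠ endorsed;
nothing here bears on whether abc is proved or refuted. [claim: Mochizuki2012, status: disputed]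
-/

noncomputable section

open Literature.AnabelianGeometry.EtaleTheta (ContH1 ThetaSetting)
open Literature.AnabelianGeometry.EtaleTheta
open _root_.Topology

namespace Literature.IUT.HodgeArakelov

namespace EtaleLevels

open CohomologySystemOfContH1 EtaleThetaDataOfSetting TemperedThetaMonoids BadPrimeGaussianMonoids
open Literature.AnabelianGeometry.EtaleTheta.SettingModel
open Literature.AnabelianGeometry.SemiGraphs

section TateRecord

open ModelTateCarriers

variable (p : ℕ) [Fact p.Prime] (l : ℕ+) (hlo : Odd (l : ℕ)) (hlp : (l : ℕ).Prime) (hdvd : 4 * (l : ℕ) ∣ p - 1)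
  {Es : Set ℕ+} (τ : (ThetaSetting.modelTate p).CyclotomeTower l Es)

/-- **[IUTchII] Prop. 3.1 (i)(ii) — the PACKAGED `Prop31Statements` AND the `θ^ι_env`-splitting clause at EVERY label, AT THE
GENUINE `θ_env` RECORD OF THE TATE MODEL, print-faithful OUTER inversion family** (`modelTate p`, Galois factor `inr`, class
`η̈♯ = etaDdχq`, `X̲̲ := Huuχq` of record, root cocycle `rootLift`, cyclotome family `τ.modAll` of a tower `τ`, EMPTY cusp
labelling, `l` an odd prime with `4l ∣ p − 1`; inversions = the `Π^tp_{X̲̲}`-conjugates of the transport `e₀ := pairRhoLim …` of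
the pointed inversion PAIR `(inversionAlpha C ι hι, ι^Θ)`, `ι := inversionχq`; `Ψ_cns := κ(O)` for a `Π^tp_{X̲̲}`-stable constant
monoid `O ≤ ℚ̄_pˣ`): the three typed clauses of `Prop31Statements` (`conj_permutes`, `splitting` for `∞θ^ι_env` at every `ι`,
`constants_stable`) hold, AND `(M^×_TM, ⟨θ^ι_env⟩)` is a splitting up to torsion for EVERY label `ι ∈ Π^tp_{X̲̲}`. Assembly:
abc-iut-w5-d072's one-label closer of record `splitting_toRecord_padic_of_eval_modelTate` (BOTH halves, label `1`, whose action
is `e₀` by `h1LimConjEquiv_one_conj_outer`) fed to abc-iut-L6-d3's generic outer-family packaging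
`prop31Statements_and_thetaEnv_thetaEnvRecordOuterKummer_of_splittings_one` (p494934). The record's own inputs (`h15`, `h15ii`,
`hι`, `hf`, `hZ`, `hlim`, `hp2`/`hpl`/`hζ`) are THEOREMS of the tree exactly as in p461404. RESIDUAL (every binder after the
`let`s) = p493591's: {(H1) `PiYddCharacteristic C` (F-2633 at the instance), the tower `τ` (DATA), `hOst` (`Π^tp_{X̲̲}`-stability
of `O`), the Cor 3.5 (K)/(E) DATA: `c`/`c₀` bijective with `μ ⊆ O` and `c₀ = c` on elements, ONE evaluation section `s₀` with
`hact` and finite-index image, `θ ∈ θ^{1}_env` with `R₀ θ = κ₀ q`, `q` a non-unit}. SEMI-SYNTHETIC MODEL, binder-discharge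
evidence only; no side taken on [IUTchIII] Cor. 3.12. [claim: Mochizuki2012, status: disputed] (IUTchII §3 Prop 3.1 (i), kurims p.87) -/
theorem prop31Statements_and_thetaEnv_thetaEnvRecordOuterKummer_modelTate
    [TopologicalSpace (PadicAlgCl p)ˣ] (O : Submonoid (PadicAlgCl p)ˣ)
    (hOtors : ∀ a : (PadicAlgCl p)ˣ, IsOfFinOrder a → a ∈ O ∧ a⁻¹ ∈ O)
    {P₀ : TopGroup.{0}} (φ₀ : P₀ →* (ThetaSetting.modelTate p).GtpTheta) [MulDistribMulAction P₀ (PadicAlgCl p)ˣ]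
    (hA₀ : ∀ b : (PadicAlgCl p)ˣ, IsOpen (MulAction.stabilizer P₀ b : Set P₀))
    (hfi₀ : ∀ b : (PadicAlgCl p)ˣ, (MulAction.stabilizer P₀ b).FiniteIndex) :
    let hS := ThetaSetting.modelχq_sec2Hyps p 1 2 even_two
    let hC := compat_modelχq p 1 2 even_two
    let K₀ := (kummerCoreχq p 1 2 even_two).toKummerDataOfSection SemidirectProduct.inr (continuous_inrχq p 1 2)
        (fun _ => rfl) (map_inr_GK_le_GtpY_modelχq' p 1 2 even_two) (map_inr_GKdd_le_GtpYdd_modelχq' p 1 2 even_two)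
    let E := K₀.etaleThetaDataOfClass (etaDdχq p 1 2 even_two)
    let C := E.doubleUnderlineχqOfEtaRes p 1 2 l hlo (eta_res_etaDdχq p 1 2 even_two l hlo)
    let h15 : ThetaSetting.Prop15iii E hC :=
      prop15iii_etaleThetaDataOfClass_etaDdχq p hC SemidirectProduct.inr (continuous_inrχq p 1 2) (fun _ => rfl)
        (map_inr_GK_le_GtpY_modelχq' p 1 2 even_two) (map_inr_GKdd_le_GtpYdd_modelχq' p 1 2 even_two)
    let L : C.CuspLabels := ⟨fun _ => ∅, fun _ => ∅, fun _ => rfl⟩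
    let hO := ThetaSetting.modelχq_isEtThOrigin p 1 2 even_two
    let hYcl := hYcl_modelχq p 1 2 even_two
    let hp2 := ne_two_of_four_mul_dvd_pred p l.pos hdvd
    let hpl := ne_of_four_mul_dvd_pred p l.pos hdvd
    let hζ := exists_isPrimitiveRoot_K_modelχq p 1 2 even_two l.pos hdvd
    let hZ : ∀ M : ℕ+, Nonempty (ModelCyclotomes.lDeltaQuot (C.rigidData (τ.modAll M) hC hS h15 L) ≃*
        Literature.IUT.HodgeTheaters.ZHat) := fun M =>
      ModelCyclotomes.nonempty_lDeltaQuot_rigidData_mulEquiv_zHat C (τ.modAll M) hC hS h15 L hO hYcl hlp.ne_zero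
    let hlim := bijective_rigidLimHom C hC hS hlp hp2 hpl hζ τ.modAll (EtaleThetaDataOfSetting.rootLift C)
      (rootLift_mem_rootCocycles C hC) τ.red_modAll h15 L hZ
    let cι : ThetaSetting.ThetaCompanion (Dα := ThetaSetting.modelTate p) (Dβ := ThetaSetting.modelTate p) (inversionχq p 1 2) :=
      (ThetaSetting.modelTate p).thetaCompanionOfAut (inversionχq p 1 2)
        (isInversionAut_inversionχq p 1 2 even_two).map_deltaTemp (hasThetaTopology_modelχq p 1 2 even_two).isQuotientMap_toTheta
    haveI := piYdd_normal C hC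
    haveI : ((ThetaSetting.modelTate p).lDeltaTheta l).Normal := ThetaSetting.lDeltaTheta_normal _ l
    haveI : IsMulCommutative ((ThetaSetting.modelTate p).lDeltaTheta l) :=
      EtaleThetaDataOfSetting.instIsMulCommutative_lDeltaTheta (D := ThetaSetting.modelTate p) l
    letI : MulDistribMulAction (Pi C) (PadicAlgCl p)ˣ := EtaleThetaDataOfSetting.unitsAction C
    ∀ (hcharY : PiYddCharacteristic C),
    let e₀ : h1Lim (phi C) ((ThetaSetting.modelTate p).lDeltaTheta l) (PiYdd C) ⊥ ≃+
        h1Lim (phi C) ((ThetaSetting.modelTate p).lDeltaTheta l) (PiYdd C) ⊥ :=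
      pairRhoLim C (inversionAlpha C (inversionχq p 1 2) (map_Huuχq_inversionχq p 1 2 l hlo)) cι.thetaIso
        (thetaCompanion_phi C (inversionχq p 1 2) (map_Huuχq_inversionχq p 1 2 l hlo) cι)
        (mem_lDeltaTheta_iff_thetaCompanion (D := ThetaSetting.modelTate p) (inversionχq p 1 2) cι l)
        (mem_PiYdd_iff_of_piYddCharacteristic C hcharY _)
    ∀ (s₀ : P₀ →* Pi C) (hs₀ : Continuous ((MonoidHom.id (Pi C)).comp s₀))
      (hN : (⊤ : Subgroup P₀).map ((MonoidHom.id (Pi C)).comp s₀) ≤ PiYdd C)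
      (hφ : (phi C).comp ((MonoidHom.id (Pi C)).comp s₀) = φ₀)
      (c : CyclotomeCoefficients (phi C) ((ThetaSetting.modelTate p).lDeltaTheta l) (PadicAlgCl p)ˣ)
      (hA : ∀ b : (PadicAlgCl p)ˣ, IsOpen (MulAction.stabilizer (Pi C) b : Set (Pi C)))
      (hfi : ∀ b : (PadicAlgCl p)ˣ, (MulAction.stabilizer (Pi C) b).FiniteIndex)
      (_hOst : ∀ (σ : Pi C) (b : (PadicAlgCl p)ˣ), b ∈ O → σ • b ∈ O)
      (c₀ : CyclotomeCoefficients φ₀ ((ThetaSetting.modelTate p).lDeltaTheta l) (PadicAlgCl p)ˣ)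
      (_hc : Function.Bijective c.hom) (_hc₀ : Function.Bijective c₀.hom) (_hc₀c : ∀ ζ, c₀.hom ζ = c.hom ζ)
      (_hact : ∀ (g : P₀) (a : (PadicAlgCl p)ˣ), g • a = s₀ g • a)
      [((EtaleThetaDataOfSetting.aug C).comp s₀).range.FiniteIndex]
      {θ : (thetaEnvRecordOuterKummer C hC hS hlp hp2 hpl hζ τ.modAll (EtaleThetaDataOfSetting.rootLift C)
        (rootLift_mem_rootCocycles C hC) τ.red_modAll h15 L hZ hcharY hlim e₀ c hA hfi O).H}
      (_hθ : θ ∈ (thetaEnvRecordOuterKummer C hC hS hlp hp2 hpl hζ τ.modAll (EtaleThetaDataOfSetting.rootLift C)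
        (rootLift_mem_rootCocycles C hC) τ.red_modAll h15 L hZ hcharY hlim e₀ c hA hfi O).thetaEnv (1 : Pi C))
      (R₀ : (thetaEnvRecordOuterKummer C hC hS hlp hp2 hpl hζ τ.modAll (EtaleThetaDataOfSetting.rootLift C)
          (rootLift_mem_rootCocycles C hC) τ.red_modAll h15 L hZ hcharY hlim e₀ c hA hfi O).H →*
        Multiplicative (h1Lim φ₀ ((ThetaSetting.modelTate p).lDeltaTheta l) (⊤ : Subgroup P₀) ⊥))
      (_hR₀ : ∀ y, Multiplicative.toAdd (R₀ y) =
        h1LimCongr ((ThetaSetting.modelTate p).lDeltaTheta l) ⊤ hφ ⊥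
          (h1LimComap (phi C) ((ThetaSetting.modelTate p).lDeltaTheta l) ((MonoidHom.id (Pi C)).comp s₀) hs₀ hN
            (AddEquiv.additiveMultiplicative (h1Lim (phi C) ((ThetaSetting.modelTate p).lDeltaTheta l) (PiYdd C) ⊥)
              (Additive.ofMul y))))
      (q : O) (_hRθ : R₀ θ = h1LimKummerOn φ₀ ((ThetaSetting.modelTate p).lDeltaTheta l) ⊤ c₀ hA₀ hfi₀ O q)
      (_hq : ¬ IsUnit q),
      TemperedThetaMonoids.Prop31Statements
          (thetaEnvRecordOuterKummer C hC hS hlp hp2 hpl hζ τ.modAll (EtaleThetaDataOfSetting.rootLift C)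
            (rootLift_mem_rootCocycles C hC) τ.red_modAll h15 L hZ hcharY hlim e₀ c hA hfi O) ∧
        ∀ j : Pi C, TemperedThetaMonoids.IsSplittingUpToTorsion
          (thetaEnvRecordOuterKummer C hC hS hlp hp2 hpl hζ τ.modAll (EtaleThetaDataOfSetting.rootLift C)
            (rootLift_mem_rootCocycles C hC) τ.red_modAll h15 L hZ hcharY hlim e₀ c hA hfi O).units
          (Submonoid.closure ((thetaEnvRecordOuterKummer C hC hS hlp hp2 hpl hζ τ.modAll
            (EtaleThetaDataOfSetting.rootLift C) (rootLift_mem_rootCocycles C hC) τ.red_modAll h15 L hZ hcharY hlim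
            e₀ c hA hfi O).thetaEnv j)) := by
  intro hS hC K₀ E C h15 L hO hYcl hp2 hpl hζ hZ hlim cι hcharY e₀ s₀ hs₀ hN hφ c hA hfi hOst c₀ hc hc₀ hc₀c hact _ θ hθ R₀
    hR₀ q hRθ hq
  haveI := piYdd_normal C hC
  haveI : ((ThetaSetting.modelTate p).lDeltaTheta l).Normal := ThetaSetting.lDeltaTheta_normal _ l
  haveI : IsMulCommutative ((ThetaSetting.modelTate p).lDeltaTheta l) :=
    EtaleThetaDataOfSetting.instIsMulCommutative_lDeltaTheta (D := ThetaSetting.modelTate p) l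
  letI : MulDistribMulAction (Pi C) (PadicAlgCl p)ˣ := EtaleThetaDataOfSetting.unitsAction C
  have hi₀ : (fun g : Pi C =>
      ((h1LimConjEquiv (phi C) ((ThetaSetting.modelTate p).lDeltaTheta l) (PiYdd C) g).symm.trans e₀).trans
        (h1LimConjEquiv (phi C) ((ThetaSetting.modelTate p).lDeltaTheta l) (PiYdd C) g)) (1 : Pi C) = e₀ :=
    h1LimConjEquiv_one_conj_outer (phi C) ((ThetaSetting.modelTate p).lDeltaTheta l) (PiYdd C) e₀
  exact prop31Statements_and_thetaEnv_thetaEnvRecordOuterKummer_of_splittings_one C hC hS hlp hp2 hpl hζ τ.modAll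
    (EtaleThetaDataOfSetting.rootLift C) (rootLift_mem_rootCocycles C hC) τ.red_modAll h15 L hZ hcharY hlim e₀ c hA hfi O
    hOst
    (splitting_toRecord_padic_of_eval_modelTate p l hlo hlp hdvd τ hcharY
      (fun g : Pi C =>
        ((h1LimConjEquiv (phi C) ((ThetaSetting.modelTate p).lDeltaTheta l) (PiYdd C) g).symm.trans e₀).trans
          (h1LimConjEquiv (phi C) ((ThetaSetting.modelTate p).lDeltaTheta l) (PiYdd C) g))
      φ₀ s₀ hs₀ hN hφ c hA hfi O c₀ hA₀ hfi₀ hc hOtors hc₀ hc₀c hact hi₀ hθ R₀ hR₀ q hRθ hq)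

end TateRecord

end EtaleLevels

end Literature.IUT.HodgeArakelov

end
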